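import Mathlib
import HarnessLib
import Literature.MathematicalPhysics.QuantumLattice.GaugeGroups
import Literature.MathematicalPhysics.QuantumFieldTheory.ConstructiveQFTWave0
import Literature.MathematicalPhysics.QuantumFieldTheory.UnitaryCayleyChart
import Literature.MathematicalPhysics.QuantumFieldTheory.CircleHaarAngle
import Literature.MathematicalPhysics.QuantumFieldTheory.Balaban1983to89.T4HaarSUNLocalDiffeo
import Summits.Ventures.LatticeQCDFlow.Scaling.LatticeEntropyU1
import Summits.Ventures.LatticeQCDFlow.Scaling.LatticeEntropyUN

/-!
# LatticeQCDFlow / Scaling — splitting Haar measure of `U(N)` along `U(1) × SU(N)` (R-T2-10 (v), part 1/2)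

HONEST FRAMING: exact (Metropolis-corrected) sampling algorithms for lattice gauge theory; figures of merit are
autocorrelation/cost numbers at stated couplings and volumes; no continuum-physics claim.

Venture `LatticeQCDFlow` (cell pub-lqcd), topic `Scaling`, FANOUT row 30 (lean-1) — OUR WORK.  Theory-2's
`Scaling/LatticeEntropySUN*.lean` reduce the `SU(N)` instance of the entropy-growth law (`κ = N² - 1`, the
`12·L⁴·log β` law for `SU(3)` in `d = 4`) to two Haar-volume statements about the ACTION BALLS
`A_r = {V ∈ SU(N) : N - Re tr V ≤ r²}`, filed there as items "classical; not in Mathlib".  This file and its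
sequel `Scaling/LatticeEntropySUNHaarVolume.lean` PROVE both for every `N ≥ 1` from the `U(N)` volumes
`σ(B(1,δ)) ≍ δ^{N²}` of `Scaling/LatticeEntropyUN.lean` (tree's `UnitaryCayleyChart`) by splitting off the
determinant.  Here, the measure-theoretic half:

* §1 circle facts: `‖e^{iθ} - 1‖² = 2 - 2cos θ`, `‖z - 1‖ ≤ |θ|` on the arc `exp(i[-t,t])`, `|arg z| ≤ (π/2)‖z - 1‖`;
  Haar of the arc is `≤ t/π` (`t < π`), so the chordal ball `{‖z - 1‖ ≤ t}` has Haar mass `≤ t/2` (`t < 2`);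
* §2 `det` is Lipschitz on `U(N)` in the Hilbert–Schmidt norm (`ContinuousMultilinearMap.norm_image_sub_le`);
* §3 `ψ(z, V) = d(z)·V`, `d(z) = diag(z,1,…,1)` (tree's `T4HaarSUNLocalDiffeo.dmat`), `U(1) × SU(N) → U(N)`, pushes
  `Haar_{U(1)} ⊗ Haar_{SU(N)}` to `Haar_{U(N)}` (`map_psi_prod`): `U₀·ψ(z,V) = ψ(z₀z, (d(z)⁻¹W₀d(z))·V)` for
  `U₀ = d(z₀)W₀` is a skew product of Haar-preserving maps (`MeasurePreserving.skew_product`), so the push-forward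
  is a left-invariant probability measure, hence Haar (`Measure.haarMeasure_unique`).  Elementary; no citations.
-/

noncomputable section

open scoped Matrix.Norms.Frobenius ENNReal NNReal
open MeasureTheory Metric Set Real
open Literature.MathematicalPhysics.QuantumFieldTheory
open Literature.MathematicalPhysics.QuantumFieldTheory.UnitaryCayley (𝔾 gball mem_gball measurableSet_gball
  gball_mono continuous_norm_coe_sub)
open Literature.MathematicalPhysics.QuantumFieldTheory.Balaban1983to89.T4HaarSUNLocalDiffeo (incl coe_incl
  continuous_incl dmat dmat_mem_unitaryGroup det_dmat dmat_mul_dmat dmat_one dmat_eq E₀ E₀_apply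
  continuous_dmat detRows detRows_apply)
open Literature.MathematicalPhysics.QuantumLattice (fundamentalRep fundamentalRep_apply unitaryFundamentalRep
  unitaryFundamentalRep_apply)

namespace Summit.Ventures.LatticeQCDFlow.Theory2.Lattice.SUNHaar

variable {N : ℕ}

/-! ## §1. Circle facts: chords, arcs and their Haar mass -/

/-- `Im e^{iθ} = sin θ`. [folklore] -/
theorem im_coe_exp (θ : ℝ) : ((Circle.exp θ : Circle) : ℂ).im = Real.sin θ := by
  rw [Circle.coe_exp]
  exact Complex.exp_ofReal_mul_I_im θ

/-- `‖e^{iθ} - 1‖² = 2 - 2cos θ`. [folklore] -/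
theorem norm_coe_exp_sub_one_sq (θ : ℝ) :
    ‖((Circle.exp θ : Circle) : ℂ) - 1‖ ^ 2 = 2 - 2 * Real.cos θ := by
  rw [Complex.sq_norm, Complex.normSq_apply, Complex.sub_re, Complex.sub_im, U1.re_coe_exp, im_coe_exp,
    Complex.one_re, Complex.one_im, sub_zero]
  nlinarith [Real.sin_sq_add_cos_sq θ]

/-- On the arc: `‖e^{iθ} - 1‖ ≤ |θ|`. [folklore] -/
theorem norm_coe_exp_sub_one_le (θ : ℝ) : ‖((Circle.exp θ : Circle) : ℂ) - 1‖ ≤ |θ| := by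
  have h1 := norm_coe_exp_sub_one_sq θ
  have h2 := Real.one_sub_sq_div_two_le_cos (x := θ)
  have h3 : ‖((Circle.exp θ : Circle) : ℂ) - 1‖ ^ 2 ≤ |θ| ^ 2 := by rw [sq_abs]; linarith
  exact le_of_pow_le_pow_left₀ two_ne_zero (abs_nonneg θ) h3

/-- Elements of the arc `exp(i[-t,t])` are within `t` of `1`. [folklore] -/
theorem norm_sub_one_le_of_mem_arc {t : ℝ} {z : Circle} (hz : z ∈ U1.arc t) : ‖(z : ℂ) - 1‖ ≤ t := by
  obtain ⟨θ, hθ, rfl⟩ := hz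
  exact (norm_coe_exp_sub_one_le θ).trans (abs_le.2 ⟨hθ.1, hθ.2⟩)

/-- **Chord controls angle**: `|arg z| ≤ (π/2)·‖z - 1‖` on the unit circle (Jordan's inequality, tree's
`U1.two_mul_sq_div_le_one_sub_cos`). [folklore] -/
theorem abs_arg_le (z : Circle) : |Complex.arg (z : ℂ)| ≤ π / 2 * ‖(z : ℂ) - 1‖ := by
  set θ := Complex.arg (z : ℂ) with hθ
  have hθπ : |θ| ≤ π := Complex.abs_arg_le_pi _
  have hz : Circle.exp θ = z := Circle.exp_arg z
  have h1 := norm_coe_exp_sub_one_sq θ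
  rw [hz] at h1
  have h2 := U1.two_mul_sq_div_le_one_sub_cos hθπ
  have hπ : 0 < π := Real.pi_pos
  have h3 : θ ^ 2 ≤ (π / 2 * ‖(z : ℂ) - 1‖) ^ 2 := by
    rw [mul_pow, div_pow, h1]
    have : 2 * θ ^ 2 ≤ π ^ 2 * (1 - Real.cos θ) := by
      rw [div_le_iff₀ (by positivity)] at h2; linarith
    nlinarith
  calc |θ| = Real.sqrt (θ ^ 2) := (Real.sqrt_sq_eq_abs θ).symm
    _ ≤ Real.sqrt ((π / 2 * ‖(z : ℂ) - 1‖) ^ 2) := Real.sqrt_le_sqrt h3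
    _ = π / 2 * ‖(z : ℂ) - 1‖ := Real.sqrt_sq (by positivity)

/-- The chordal ball `{‖z - 1‖ ≤ t}` lies in the arc `exp(i[-πt/2, πt/2])`. [folklore] -/
theorem chordBall_subset_arc (t : ℝ) : {z : Circle | ‖(z : ℂ) - 1‖ ≤ t} ⊆ U1.arc (π / 2 * t) := by
  intro z hz
  rw [mem_setOf_eq] at hz
  refine ⟨Complex.arg (z : ℂ), ?_, Circle.exp_arg z⟩
  have h := (abs_arg_le z).trans (mul_le_mul_of_nonneg_left hz (by positivity))
  exact ⟨(abs_le.1 h).1, (abs_le.1 h).2⟩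

/-- **Haar mass of an arc, upper bound**: `Haar(exp(i[-t,t])) ≤ t/π` for `0 ≤ t < π` (the preimage of
the arc in `(-π, π]` is exactly `[-t, t]`). [folklore] -/
theorem haar_arc_le {t : ℝ} (ht0 : 0 ≤ t) (htπ : t < π) :
    (haarProbability Circle (U1.arc t)).toReal ≤ t / π := by
  have hπ : 0 < π := Real.pi_pos
  rw [← CircleHaar.map_exp_angleMeasure,
    Measure.map_apply Circle.exp.continuous.measurable (U1.measurableSet_arc t), CircleHaar.angleMeasure,
    Measure.smul_apply, Measure.restrict_apply (measurableSet_preimage Circle.exp.continuous.measurable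
      (U1.measurableSet_arc t)), smul_eq_mul]
  -- the trace of the preimage on `(-π, π]` is contained in `[-t, t]`
  have hsub : Circle.exp ⁻¹' U1.arc t ∩ Ioc (-π) π ⊆ Icc (-t) t := by
    rintro θ ⟨⟨φ, hφ, hφθ⟩, hθ⟩
    obtain ⟨m, hm⟩ := Circle.exp_eq_exp.1 hφθ
    have hφb := abs_le.2 ⟨hφ.1, hφ.2⟩
    have hm0 : (m : ℝ) = 0 := by
      have h1 : |(m : ℝ)| * (2 * π) = |φ - θ| := by
        rw [show φ - θ = m * (2 * π) by rw [hm]; ring, abs_mul, abs_of_pos (by positivity : (0:ℝ) < 2 * π)]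
      have h2 : |φ - θ| < 2 * π := by
        rw [abs_lt]; constructor <;> linarith [hφ.1, hφ.2, hθ.1, hθ.2]
      have h3 : |(m : ℝ)| < 1 := by nlinarith
      have h4 : |m| < 1 := by exact_mod_cast h3
      rw [Int.abs_lt_one_iff.1 h4, Int.cast_zero]
    have hφθ' : φ = θ := by rw [hm, hm0, zero_mul, add_zero]
    rw [← hφθ']
    exact hφ
  have hle : volume (Circle.exp ⁻¹' U1.arc t ∩ Ioc (-π) π) ≤ ENNReal.ofReal (2 * t) := by
    calc volume (Circle.exp ⁻¹' U1.arc t ∩ Ioc (-π) π) ≤ volume (Icc (-t) t) := measure_mono hsub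
      _ = ENNReal.ofReal (2 * t) := by rw [Real.volume_Icc]; ring_nf
  have hfin : (ENNReal.ofReal (2 * Real.pi))⁻¹ * ENNReal.ofReal (2 * t) ≠ ⊤ :=
    ENNReal.mul_ne_top (ENNReal.inv_ne_top.2 CircleHaar.ofReal_two_pi_ne_zero) ENNReal.ofReal_ne_top
  calc ((ENNReal.ofReal (2 * Real.pi))⁻¹ * volume (Circle.exp ⁻¹' U1.arc t ∩ Ioc (-π) π)).toReal
      ≤ ((ENNReal.ofReal (2 * Real.pi))⁻¹ * ENNReal.ofReal (2 * t)).toReal :=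
        ENNReal.toReal_mono hfin (mul_le_mul' le_rfl hle)
    _ = t / π := by
        rw [ENNReal.toReal_mul, ENNReal.toReal_inv, ENNReal.toReal_ofReal (by positivity),
          ENNReal.toReal_ofReal (by positivity)]
        field_simp

/-- The chordal ball is closed, hence measurable. [folklore] -/
theorem measurableSet_chordBall (t : ℝ) : MeasurableSet {z : Circle | ‖(z : ℂ) - 1‖ ≤ t} := by
  have hc : Continuous fun z : Circle => ‖(z : ℂ) - 1‖ :=
    ((continuous_subtype_val : Continuous fun z : Circle => (z : ℂ)).sub continuous_const).norm
  exact (isClosed_le hc continuous_const).measurableSet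

/-- **Haar mass of a chordal ball**: `Haar{z ∈ U(1) : ‖z - 1‖ ≤ t} ≤ t/2` for `0 ≤ t < 2`. [folklore] -/
theorem haar_chordBall_le {t : ℝ} (ht0 : 0 ≤ t) (ht2 : t < 2) :
    (haarProbability Circle {z : Circle | ‖(z : ℂ) - 1‖ ≤ t}).toReal ≤ t / 2 := by
  have hπ : 0 < π := Real.pi_pos
  have h1 : (haarProbability Circle {z : Circle | ‖(z : ℂ) - 1‖ ≤ t}).toReal ≤
      (haarProbability Circle (U1.arc (π / 2 * t))).toReal :=
    ENNReal.toReal_mono (measure_ne_top _ _) (measure_mono (chordBall_subset_arc t))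
  have h2 := haar_arc_le (t := π / 2 * t) (by positivity) (by nlinarith)
  calc _ ≤ _ := h1
    _ ≤ π / 2 * t / π := h2
    _ = t / 2 := by field_simp

/-! ## §2. The determinant is Lipschitz on `U(N)` for the Hilbert–Schmidt norm -/

/-- An entry is bounded by the Hilbert–Schmidt norm. [folklore] -/
theorem norm_entry_le (A : Matrix (Fin N) (Fin N) ℂ) (i j : Fin N) : ‖A i j‖ ≤ ‖A‖ := by
  have h : ‖A i j‖ ^ 2 ≤ ‖A‖ ^ 2 := by
    rw [UnitaryCayley.frobenius_norm_sq A]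
    calc ‖A i j‖ ^ 2 ≤ ∑ k, ‖A i k‖ ^ 2 :=
          Finset.single_le_sum (f := fun k => ‖A i k‖ ^ 2) (fun k _ => sq_nonneg _) (Finset.mem_univ j)
      _ ≤ ∑ i', ∑ k, ‖A i' k‖ ^ 2 :=
          Finset.single_le_sum (f := fun i' => ∑ k, ‖A i' k‖ ^ 2)
            (fun _ _ => Finset.sum_nonneg fun _ _ => sq_nonneg _) (Finset.mem_univ i)
  exact le_of_pow_le_pow_left₀ two_ne_zero (norm_nonneg _) h

/-- The rows of a unitary matrix, as a tuple of vectors in the sup norm, have norm `≤ 1`. [folklore] -/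
theorem pi_norm_rows_le_one (U : 𝔾 N) :
    ‖(fun i j => (U : Matrix (Fin N) (Fin N) ℂ) i j : Fin N → Fin N → ℂ)‖ ≤ 1 := by
  refine (pi_norm_le_iff_of_nonneg zero_le_one).2 fun i => (pi_norm_le_iff_of_nonneg zero_le_one).2 fun j => ?_
  exact entry_norm_bound_of_unitary U.2 i j

/-- The sup norm of the row tuple of a difference is at most the Hilbert–Schmidt norm. [folklore] -/
theorem pi_norm_rows_sub_le (A B : Matrix (Fin N) (Fin N) ℂ) :
    ‖(fun i j => A i j : Fin N → Fin N → ℂ) - (fun i j => B i j : Fin N → Fin N → ℂ)‖ ≤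
      ‖A - B‖ := by
  refine (pi_norm_le_iff_of_nonneg (norm_nonneg _)).2 fun i =>
    (pi_norm_le_iff_of_nonneg (norm_nonneg _)).2 fun j => ?_
  exact norm_entry_le (A - B) i j

/-- `detRows` evaluated on the rows of `A` is `det A`. [folklore] -/
theorem detRows_rows (A : Matrix (Fin N) (Fin N) ℂ) : detRows N (fun i j => A i j) = A.det := by
  rw [detRows_apply]; rfl

/-- **`det` is Lipschitz on `U(N)`**: `|det U - det W| ≤ K·‖U - W‖_F` with one `K = K_N ≥ 1`
(multilinearity: `ContinuousMultilinearMap.norm_image_sub_le`). [folklore] -/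
theorem exists_det_lipschitz : ∃ K : ℝ, 1 ≤ K ∧ ∀ U W : 𝔾 N,
    ‖(U : Matrix (Fin N) (Fin N) ℂ).det - (W : Matrix (Fin N) (Fin N) ℂ).det‖ ≤
      K * ‖(U : Matrix (Fin N) (Fin N) ℂ) - W‖ := by
  refine ⟨max 1 (‖detRows N‖ * N), le_max_left _ _, fun U W => ?_⟩
  set u : Fin N → Fin N → ℂ := fun i j => (U : Matrix (Fin N) (Fin N) ℂ) i j with hu
  set w : Fin N → Fin N → ℂ := fun i j => (W : Matrix (Fin N) (Fin N) ℂ) i j with hw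
  have h := (detRows N).norm_image_sub_le u w
  rw [hu, hw, detRows_rows, detRows_rows, Fintype.card_fin] at h
  have hmax : max ‖u‖ ‖w‖ ≤ 1 := max_le (pi_norm_rows_le_one U) (pi_norm_rows_le_one W)
  have hmax0 : 0 ≤ max ‖u‖ ‖w‖ := le_max_of_le_left (norm_nonneg _)
  have hpow : max ‖u‖ ‖w‖ ^ (N - 1) ≤ 1 := pow_le_one₀ hmax0 hmax
  have hsub := pi_norm_rows_sub_le (U : Matrix (Fin N) (Fin N) ℂ) (W : Matrix (Fin N) (Fin N) ℂ)
  have h0 : 0 ≤ ‖detRows N‖ * N := by positivity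
  calc ‖(U : Matrix (Fin N) (Fin N) ℂ).det - (W : Matrix (Fin N) (Fin N) ℂ).det‖
      ≤ ‖detRows N‖ * N * max ‖u‖ ‖w‖ ^ (N - 1) * ‖u - w‖ := h
    _ ≤ ‖detRows N‖ * N * 1 * ‖(U : Matrix (Fin N) (Fin N) ℂ) - W‖ := by
        apply mul_le_mul _ hsub (norm_nonneg _) (by positivity)
        exact mul_le_mul_of_nonneg_left hpow h0
    _ ≤ max 1 (‖detRows N‖ * N) * ‖(U : Matrix (Fin N) (Fin N) ℂ) - W‖ := by
        rw [mul_one]; exact mul_le_mul_of_nonneg_right (le_max_right _ _) (norm_nonneg _)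

/-! ## §3. `ψ(z, V) = diag(z,1,…,1)·V` pushes `Haar_{U(1)} ⊗ Haar_{SU(N)}` to `Haar_{U(N)}` -/

/-- `z·z̄ = 1` on the unit circle. [folklore] -/
theorem coe_mul_star_coe (z : Circle) : (z : ℂ) * star (z : ℂ) = 1 := by
  rw [Complex.star_def, Complex.mul_conj, Circle.normSq_coe, Complex.ofReal_one]

/-- The determinant of `U₀ ∈ U(N)` as an element of `U(1)` (for the LEFT splitting `U₀ = d(det U₀)·W₀`).
[folklore] -/
def detC (U : 𝔾 N) : Circle :=
  ⟨(U : Matrix (Fin N) (Fin N) ℂ).det, by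
    have h := Balaban1983to89.T4HaarSUNLocalDiffeo.det_mul_star_det U.2
    rw [Complex.star_def, Complex.mul_conj] at h
    have h1 : Complex.normSq (U : Matrix (Fin N) (Fin N) ℂ).det = 1 := by exact_mod_cast h
    have h2 : ‖(U : Matrix (Fin N) (Fin N) ℂ).det‖ = 1 := by
      rw [← Real.sqrt_sq (norm_nonneg _), ← Complex.normSq_eq_norm_sq, h1, Real.sqrt_one]
    exact mem_sphere_zero_iff_norm.2 h2⟩

/-- The value of `detC`. [folklore] -/
@[simp] theorem coe_detC (U : 𝔾 N) : ((detC U : Circle) : ℂ) = (U : Matrix (Fin N) (Fin N) ℂ).det := rfl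

section Psi

variable [NeZero N]

/-- The diagonal embedding `U(1) → U(N)`, `z ↦ d(z) = diag(z, 1, …, 1)`. [folklore] -/
def dC (z : Circle) : 𝔾 N := ⟨dmat (z : ℂ), dmat_mem_unitaryGroup (coe_mul_star_coe z)⟩

/-- The matrix of `d(z)`. [folklore] -/
@[simp] theorem coe_dC (z : Circle) : ((dC z : 𝔾 N) : Matrix (Fin N) (Fin N) ℂ) = dmat (z : ℂ) := rfl

/-- `d` is multiplicative. [folklore] -/
theorem dC_mul (z w : Circle) : (dC z : 𝔾 N) * dC w = dC (z * w) :=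
  Subtype.ext (by simp only [coe_dC, Circle.coe_mul]; exact dmat_mul_dmat _ _)

/-- `d(1) = 1`. [folklore] -/
theorem dC_one : (dC 1 : 𝔾 N) = 1 := Subtype.ext (by rw [coe_dC, Circle.coe_one, dmat_one]; rfl)

/-- `d(z⁻¹) = d(z)⁻¹`. [folklore] -/
theorem dC_inv (z : Circle) : (dC z⁻¹ : 𝔾 N) = (dC z)⁻¹ := by
  rw [eq_inv_iff_mul_eq_one, dC_mul, inv_mul_cancel, dC_one]

/-- `det d(z) = z`. [folklore] -/
theorem det_coe_dC (z : Circle) : ((dC z : 𝔾 N) : Matrix (Fin N) (Fin N) ℂ).det = z := by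
  rw [coe_dC]; exact det_dmat _

/-- `‖E₀‖_F = 1`. [folklore] -/
theorem norm_E₀ : ‖(E₀ : Matrix (Fin N) (Fin N) ℂ)‖ = 1 := by
  have h : ‖(E₀ : Matrix (Fin N) (Fin N) ℂ)‖ ^ 2 = 1 := by
    rw [UnitaryCayley.frobenius_norm_sq]
    rw [Finset.sum_eq_single (0 : Fin N) (fun j _ hj => ?_) (fun h => (h (Finset.mem_univ _)).elim)]
    · rw [Finset.sum_eq_single (0 : Fin N) (fun k _ hk => ?_) (fun h => (h (Finset.mem_univ _)).elim)]
      · simp [E₀_apply]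
      · simp [E₀_apply, hk]
    · refine Finset.sum_eq_zero fun k _ => ?_
      simp [E₀_apply, hj]
  have h0 : 0 ≤ ‖(E₀ : Matrix (Fin N) (Fin N) ℂ)‖ := norm_nonneg _
  nlinarith [sq_nonneg (‖(E₀ : Matrix (Fin N) (Fin N) ℂ)‖ - 1)]

/-- `‖d(z) - 1‖_F = ‖z - 1‖`. [folklore] -/
theorem norm_coe_dC_sub_one (z : Circle) :
    ‖((dC z : 𝔾 N) : Matrix (Fin N) (Fin N) ℂ) - 1‖ = ‖(z : ℂ) - 1‖ := by
  rw [coe_dC, dmat_eq, add_sub_cancel_left, norm_smul, norm_E₀, mul_one]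

/-- `d` is continuous. [folklore] -/
theorem continuous_dC : Continuous (dC : Circle → 𝔾 N) :=
  Continuous.subtype_mk (continuous_dmat.comp continuous_subtype_val) _

/-- **The splitting map** `ψ(z, V) = d(z)·V : U(1) × SU(N) → U(N)`. [folklore] -/
def psi (p : Circle × Matrix.specialUnitaryGroup (Fin N) ℂ) : 𝔾 N := dC p.1 * incl p.2

/-- `ψ` is continuous. [folklore] -/
theorem continuous_psi : Continuous (psi (N := N)) :=
  (continuous_dC.comp continuous_fst).mul (continuous_incl.comp continuous_snd)

/-- `ψ` is measurable. [folklore] -/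
theorem measurable_psi : Measurable (psi (N := N)) := continuous_psi.measurable

/-- The matrix of `ψ(z, V)` is `d(z)·V`. [folklore] -/
theorem coe_psi (z : Circle) (V : Matrix.specialUnitaryGroup (Fin N) ℂ) :
    ((psi (z, V) : 𝔾 N) : Matrix (Fin N) (Fin N) ℂ) = dmat (z : ℂ) * (V : Matrix (Fin N) (Fin N) ℂ) := rfl

/-- `det ψ(z, V) = z`. [folklore] -/
theorem det_coe_psi (z : Circle) (V : Matrix.specialUnitaryGroup (Fin N) ℂ) :
    ((psi (z, V) : 𝔾 N) : Matrix (Fin N) (Fin N) ℂ).det = z := by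
  rw [coe_psi, Matrix.det_mul, det_dmat, (Matrix.mem_specialUnitaryGroup_iff.mp V.2).2, mul_one]

/-- Conjugation of an element of `SU(N)` by `d(z)`: `d(z)⁻¹·W·d(z) ∈ SU(N)`. [folklore] -/
def conjSU (z : Circle) (W : Matrix.specialUnitaryGroup (Fin N) ℂ) : Matrix.specialUnitaryGroup (Fin N) ℂ :=
  ⟨(((dC z)⁻¹ * incl W * dC z : 𝔾 N) : Matrix (Fin N) (Fin N) ℂ), by
    rw [Matrix.mem_specialUnitaryGroup_iff]
    refine ⟨((dC z)⁻¹ * incl W * dC z : 𝔾 N).2, ?_⟩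
    rw [Submonoid.coe_mul, Submonoid.coe_mul, Matrix.det_mul, Matrix.det_mul, ← dC_inv, det_coe_dC,
      det_coe_dC, coe_incl, (Matrix.mem_specialUnitaryGroup_iff.mp W.2).2, Circle.coe_inv, mul_one,
      inv_mul_cancel₀ (Circle.coe_ne_zero z)]⟩

/-- The matrix of `conjSU z W` inside `U(N)`. [folklore] -/
theorem incl_conjSU (z : Circle) (W : Matrix.specialUnitaryGroup (Fin N) ℂ) :
    incl (conjSU z W) = (dC z)⁻¹ * incl W * dC z := rfl

/-- `z ↦ d(z)⁻¹ W d(z)` is continuous. [folklore] -/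
theorem continuous_conjSU (W : Matrix.specialUnitaryGroup (Fin N) ℂ) : Continuous fun z : Circle => conjSU z W := by
  refine Continuous.subtype_mk ?_ _
  exact continuous_subtype_val.comp ((continuous_dC.inv.mul continuous_const).mul continuous_dC)

/-- The `SU(N)` factor `W₀ = d(det U₀)⁻¹·U₀`. [folklore] -/
def suPart (U : 𝔾 N) : Matrix.specialUnitaryGroup (Fin N) ℂ :=
  ⟨(((dC (detC U))⁻¹ * U : 𝔾 N) : Matrix (Fin N) (Fin N) ℂ), by
    rw [Matrix.mem_specialUnitaryGroup_iff]
    refine ⟨((dC (detC U))⁻¹ * U : 𝔾 N).2, ?_⟩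
    rw [Submonoid.coe_mul, Matrix.det_mul, ← dC_inv, det_coe_dC, Circle.coe_inv, coe_detC,
      inv_mul_cancel₀]
    exact Circle.coe_ne_zero (detC U)⟩

/-- `U₀ = ψ(det U₀, W₀)`. [folklore] -/
theorem psi_detC_suPart (U : 𝔾 N) : psi (detC U, suPart U) = U := by
  apply Subtype.ext
  show ((dC (detC U) : 𝔾 N) : Matrix (Fin N) (Fin N) ℂ) *
      (((dC (detC U))⁻¹ * U : 𝔾 N) : Matrix (Fin N) (Fin N) ℂ) = U
  rw [← Submonoid.coe_mul, ← mul_assoc, mul_inv_cancel, one_mul]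

/-- **Equivariance**: `U₀ · ψ(z, V) = ψ(det U₀ · z, (d(z)⁻¹ W₀ d(z)) · V)`. [folklore] -/
theorem mul_psi (U : 𝔾 N) (z : Circle) (V : Matrix.specialUnitaryGroup (Fin N) ℂ) :
    U * psi (z, V) = psi (detC U * z, conjSU z (suPart U) * V) := by
  conv_lhs => rw [← psi_detC_suPart U]
  apply Subtype.ext
  show ((dC (detC U) * incl (suPart U)) * (dC z * incl V) : 𝔾 N).1 =
    ((dC (detC U * z) * incl (conjSU z (suPart U) * V) : 𝔾 N)).1
  have hincl : incl (conjSU z (suPart U) * V) = (dC z)⁻¹ * incl (suPart U) * dC z * incl V := by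
    apply Subtype.ext
    show ((conjSU z (suPart U) : Matrix (Fin N) (Fin N) ℂ) * (V : Matrix (Fin N) (Fin N) ℂ)) = _
    rfl
  rw [hincl, ← dC_mul]
  congr 1
  group

/-- **`ψ_*(Haar_{U(1)} ⊗ Haar_{SU(N)}) = Haar_{U(N)}`**: the push-forward is a left-invariant probability
measure on `U(N)` — left multiplication by `U₀ = d(z₀)W₀` corresponds under `ψ` to the skew product
`(z, V) ↦ (z₀z, (d(z)⁻¹W₀d(z))·V)` of Haar-preserving maps — hence the Haar probability measure.
[folklore] -/
theorem map_psi_prod :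
    ((haarProbability Circle).prod (haarProbability (Matrix.specialUnitaryGroup (Fin N) ℂ))).map psi =
      haarProbability (𝔾 N) := by
  haveI : IsProbabilityMeasure
      (((haarProbability Circle).prod (haarProbability (Matrix.specialUnitaryGroup (Fin N) ℂ))).map
        (psi (N := N))) :=
    Measure.isProbabilityMeasure_map measurable_psi.aemeasurable
  haveI : (((haarProbability Circle).prod (haarProbability (Matrix.specialUnitaryGroup (Fin N) ℂ))).map
      (psi (N := N))).IsMulLeftInvariant := by
    refine ⟨fun U => ?_⟩
    have hU : Measurable fun x : 𝔾 N => U * x := (continuous_const.mul continuous_id).measurable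
    -- the skew product on `U(1) × SU(N)` corresponding to left multiplication by `U`
    have hTpres : MeasurePreserving
        (fun p : Circle × Matrix.specialUnitaryGroup (Fin N) ℂ => (detC U * p.1, conjSU p.1 (suPart U) * p.2))
        ((haarProbability Circle).prod (haarProbability (Matrix.specialUnitaryGroup (Fin N) ℂ)))
        ((haarProbability Circle).prod (haarProbability (Matrix.specialUnitaryGroup (Fin N) ℂ))) := by
      refine (measurePreserving_mul_left (haarProbability Circle) (detC U)).skew_product
        (g := fun z V => conjSU z (suPart U) * V) ?_ (Filter.Eventually.of_forall fun z => ?_)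
      · show Measurable fun p : Circle × Matrix.specialUnitaryGroup (Fin N) ℂ => conjSU p.1 (suPart U) * p.2
        exact (((continuous_conjSU (suPart U)).comp continuous_fst).mul continuous_snd).measurable
      · exact map_mul_left_eq_self _ _
    have hcomp : (fun x : 𝔾 N => U * x) ∘ psi =
        psi ∘ (fun p : Circle × Matrix.specialUnitaryGroup (Fin N) ℂ =>
          (detC U * p.1, conjSU p.1 (suPart U) * p.2)) := by
      funext p; exact mul_psi U p.1 p.2
    rw [Measure.map_map hU measurable_psi, hcomp, ← Measure.map_map measurable_psi hTpres.measurable,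
      hTpres.map_eq]
  have h := Measure.haarMeasure_unique
    (((haarProbability Circle).prod (haarProbability (Matrix.specialUnitaryGroup (Fin N) ℂ))).map
      (psi (N := N))) (⊤ : TopologicalSpace.PositiveCompacts (𝔾 N))
  rw [h, TopologicalSpace.PositiveCompacts.coe_top, measure_univ, one_smul]
  rfl

/-- Haar measure of `U(N)` of a measurable set, computed on `U(1) × SU(N)`. [folklore] -/
theorem haar_eq_prod_preimage {S : Set (𝔾 N)} (hS : MeasurableSet S) :
    haarProbability (𝔾 N) S =
      ((haarProbability Circle).prod (haarProbability (Matrix.specialUnitaryGroup (Fin N) ℂ))) (psi ⁻¹' S) := by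
  rw [← map_psi_prod, Measure.map_apply measurable_psi hS]

end Psi

end Summit.Ventures.LatticeQCDFlow.Theory2.Lattice.SUNHaar

end
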